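import Summits.AtomisticToContinuum.Crystallization.Theorems.LayeredLawsSelectHcp.Negative.IntendedModel

/-!
# Negative knowledge for crux `LayeredLawsSelectHcp` (stmt-AtomisticToContinuum-9226), XIV:
# every ideal polytype is layered; the crux on ideal periodic polytypes = attainment form of Hägg selection

Part XIV (`--supports stmt-AtomisticToContinuum-9226`). `zIso` (the mirror `diag(1, 1, −1)` as a linear
isometry, for twin `c`-sites; `zIso_combo`: it fixes `u, v, w` and reverses `n`), `fccInt_rel` (the FCC table, by
`decide`), `hexIso_fccPattern`, and **`goodShell_barlowStacking_ideal`**: EVERY point of EVERY ideal Barlow stacking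
of spacing `a ∈ [9/10, 1]` has an exact `(1/100)`-good shell in the sense of the crux's H4 — a rotated scaled
cuboctahedron at `c`-sites (`M` for letter shifts `(+1, −1)`, `Z∘M` for the twin `(−1, +1)`), an anticuboctahedron at
`h`-sites (`±M`). With part X (`barlowLike_barlowStacking_ideal`) this shows H4 is BLIND to the stacking (barrier
`KissingTwelveDegeneracy` at the level of the crux's own predicates): the Palm law of every ideal PERIODIC polytype
satisfies H1, H2, H4 (**`barlowPalm_hypotheses`**), so the crux restricted to ideal periodic polytypes is exactly
**`isRelaxedHcp_of_crux_barlow`**: `crux ⇒ (e(barlowPeriodicConfiguration a (a√⅔) s) ≤ e* ⇒ every motif view is a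
linear-isometric copy of an optimal hcpStacking)` — the ATTAINMENT form of Hägg selection; one ideal polytype
attaining `e*` with a non-hcp view would refute the crux, and that is precisely where the uncertified interlayer
couplings `J_k` (items 0670/3063) enter. All `[folklore]`.
-/

noncomputable section

namespace Summit.AtomisticToContinuum.Crystallization.Theorems.LayeredLawsSelectHcp.Negative.AllStackings

open MeasureTheory Set
open Literature.MathematicalPhysics.StatisticalMechanics Literature.Geometry.DiscreteGeometry
open Summit.AtomisticToContinuum.Crystallization.Theses.PalmUnimodularRigidity (LayeredLawsSelectHcp)
open Summit.AtomisticToContinuum.Crystallization.Theorems.ChargedEnergyGapNegative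
  (eStar eStar_le bddBelow_energyPerParticle_lennardJones)
open Summit.AtomisticToContinuum.Crystallization.Theorems.LayeredLawsSelectHcp.Negative.DiracLaws
open Summit.AtomisticToContinuum.Crystallization.Theorems.LayeredLawsSelectHcp.Negative.IntegerForms
open Summit.AtomisticToContinuum.Crystallization.Theorems.LayeredLawsSelectHcp.Negative.IdealStackings
open Summit.AtomisticToContinuum.Crystallization.Theorems.LayeredLawsSelectHcp.Negative.HexCubic
open Summit.AtomisticToContinuum.Crystallization.Theorems.LayeredLawsSelectHcp.Negative.HcpShells
open Summit.AtomisticToContinuum.Crystallization.Theorems.LayeredLawsSelectHcp.Negative.PeriodicPalmLaw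
open Summit.AtomisticToContinuum.Crystallization.Theorems.LayeredLawsSelectHcp.Negative.PeriodicEnergy
open Summit.AtomisticToContinuum.Crystallization.Theorems.LayeredLawsSelectHcp.Negative.IntendedModel

/-- Euclidean `3`-space. [folklore] -/
local notation "E3" => EuclideanSpace ℝ (Fin 3)

/-! ## Every ideal Barlow stacking has exact good shells at EVERY point (all four site types);
the crux restricted to ideal periodic polytypes -/

section AllStackings

/-! ### The `z`-mirror `Z = diag(1, 1, −1)` (for twin `c`-sites) -/

/-- Integer rows of `Z`. [folklore] -/
def zrowInt : Fin 3 → (Fin 3 → ℤ) := ![![1, 0, 0], ![0, 1, 0], ![0, 0, -1]]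

/-- The rows of `Z` (unit vectors `e₀, e₁, −e₂`). [folklore] -/
def zrow (l : Fin 3) : E3 := intVec (zrowInt l)

/-- The rows of `Z` are orthonormal. [folklore] -/
theorem inner_zrow (l l' : Fin 3) : inner ℝ (zrow l) (zrow l') = if l = l' then (1 : ℝ) else 0 := by
  by_cases hll : l = l'
  · subst hll
    have hn : ‖zrow l‖ = 1 := by
      fin_cases l <;> simp [zrow, zrowInt, norm_intVec, sqNormInt]
    rw [if_pos rfl, real_inner_self_eq_norm_sq, hn, one_pow]
  · rw [if_neg hll]
    fin_cases l <;> fin_cases l' <;> first | exact absurd rfl hll |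
      (simp [zrow, zrowInt, inner_intVec])

/-- As an orthonormal family. [folklore] -/
theorem orthonormal_zrow : Orthonormal ℝ zrow :=
  orthonormal_iff_ite.2 inner_zrow

/-- The orthonormal basis `(e₀, e₁, −e₂)`. [folklore] -/
def zBasis3 : OrthonormalBasis (Fin 3) ℝ E3 :=
  (basisOfOrthonormalOfCardEqFinrank orthonormal_zrow (by simp)).toOrthonormalBasis
    (by rw [coe_basisOfOrthonormalOfCardEqFinrank]; exact orthonormal_zrow)

/-- Its vectors. [folklore] -/
@[simp] theorem zBasis3_apply (l : Fin 3) : zBasis3 l = zrow l := by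
  rw [zBasis3, Module.Basis.coe_toOrthonormalBasis, coe_basisOfOrthonormalOfCardEqFinrank]

/-- **The mirror `Z : (x, y, z) ↦ (x, y, −z)`** as a linear isometry. [folklore] -/
def zIso : E3 →ₗᵢ[ℝ] E3 := zBasis3.repr.toLinearIsometry

/-- Coordinates of `Z x`. [folklore] -/
theorem zIso_apply (x : E3) (l : Fin 3) : zIso x l = inner ℝ (zrow l) x := by
  simp [zIso, OrthonormalBasis.repr_apply_apply]

/-- `Z` fixes the layer vectors `u, v, w` and reverses `n`. [folklore] -/
theorem zIso_combo (i j Λ K η : ℝ) :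
    zIso (i • triangularVec₁ 1 + j • triangularVec₂ 1 + Λ • barlowOffset 1 + K • layerNormal η) =
      i • triangularVec₁ 1 + j • triangularVec₂ 1 + Λ • barlowOffset 1 + (-K) • layerNormal η := by
  ext l
  rw [zIso_apply]
  fin_cases l <;>
    simp [zrow, zrowInt, PiLp.inner_apply, Fin.sum_univ_three, intVec_apply, triangularVec₁,
      triangularVec₂, barlowOffset, layerNormal]

/-! ### The fcc table -/

/-- The table `q ↦ (i, j, Λ, K)` for the cuboctahedron `fccInt/√2`: `M` maps it to the shell of a
`c`-site with letter shifts `+1` up, `−1` down (`Λ = K`). [folklore] -/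
def fccOffsetIdx : Finset (ℤ × ℤ × ℤ × ℤ) :=
  {(1, 0, 0, 0), (-1, 0, 0, 0), (1, -1, 0, 0), (-1, 1, 0, 0), (0, -1, 0, 0), (0, 1, 0, 0),
   (0, -1, 1, 1), (0, 0, 1, 1), (-1, 0, 1, 1), (0, 1, -1, -1), (0, 0, -1, -1), (1, 0, -1, -1)}

/-- The integer relations for the FCC pattern (by `decide`). [folklore] -/
theorem fccInt_rel : ∀ q ∈ fccInt, ∃ t ∈ fccOffsetIdx,
    q 0 - q 1 = 2 * t.1 + t.2.1 + t.2.2.1 ∧ -q 0 - q 1 + 2 * q 2 = 3 * t.2.1 + t.2.2.1 ∧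
      q 0 + q 1 + q 2 = 2 * t.2.2.2 := by
  decide

/-- Shape of the fcc table: `Λ = K ∈ {0, ±1}`. [folklore] -/
theorem fccOffsetIdx_shape : ∀ t ∈ fccOffsetIdx,
    (t.2.2.2 = 0 ∧ t.2.2.1 = 0) ∨ (t.2.2.2 = 1 ∧ t.2.2.1 = 1) ∨ (t.2.2.2 = -1 ∧ t.2.2.1 = -1) := by
  decide

/-- **`M` maps each point of the FCC kissing pattern to a tabulated `c`-site offset.** [folklore] -/
theorem hexIso_fccPattern (q : E3) (hq : q ∈ fccKissingPattern) :
    ∃ t ∈ fccOffsetIdx, hexIso q =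
      (t.1 : ℝ) • triangularVec₁ 1 + (t.2.1 : ℝ) • triangularVec₂ 1 + (t.2.2.1 : ℝ) • barlowOffset 1 +
        (t.2.2.2 : ℝ) • layerNormal (Real.sqrt (2 / 3)) := by
  obtain ⟨p, hp, rfl⟩ := Finset.mem_image.1 hq
  obtain ⟨t, ht, r1, r2, r3⟩ := fccInt_rel p hp
  refine ⟨t, ht, ?_⟩
  have hc : (Real.sqrt ((2 : ℕ) : ℝ))⁻¹ * Real.sqrt 2 = 1 := by
    rw [Nat.cast_ofNat]; exact inv_mul_cancel₀ (by positivity)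
  have r1' : ((p 0 : ℤ) : ℝ) - p 1 = 2 * t.1 + t.2.1 + t.2.2.1 := by exact_mod_cast r1
  have r2' : -((p 0 : ℤ) : ℝ) - p 1 + 2 * p 2 = 3 * t.2.1 + t.2.2.1 := by exact_mod_cast r2
  have r3' : ((p 0 : ℤ) : ℝ) + p 1 + p 2 = 2 * t.2.2.2 := by exact_mod_cast r3
  refine hexIso_smul_intVec _ p _ _ _ _ ?_ ?_ ?_
  · rw [r1', hc]; ring
  · rw [r2', hc]; ring
  · rw [r3', hc]; ring

/-! ### Shells of an arbitrary ideal Barlow stacking -/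

variable {a : ℝ} {s : ℤ → ℤ}

/-- The pattern at a site of layer `k`: FCC at `c`-sites (`s k = s (k−1)`), HCP at `h`-sites. [folklore] -/
def sitePattern (s : ℤ → ℤ) (k : ℤ) : Finset E3 :=
  if s k = s (k - 1) then fccKissingPattern else hcpKissingPattern

/-- The isometry at a site of layer `k`: `M` / `Z ∘ M` at `c`-sites, `M` / `−M` at `h`-sites, according
to the sign of `s k`. [folklore] -/
def siteIso' (s : ℤ → ℤ) (k : ℤ) : E3 →ₗᵢ[ℝ] E3 :=
  if s k = 1 then hexIso
  else if s k = s (k - 1) then zIso.comp hexIso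
  else (LinearIsometryEquiv.neg ℝ (E := E3)).toLinearIsometry.comp hexIso

/-- The candidate shell at a site of layer `k`. [folklore] -/
def shellFinset' (a : ℝ) (s : ℤ → ℤ) (k : ℤ) : Finset E3 :=
  ((sitePattern s k).image fun v : E3 => a • v).image (siteIso' s k)

/-- The pattern at any site has twelve points of norm `1`. [folklore] -/
theorem sitePattern_card_norm (s : ℤ → ℤ) (k : ℤ) :
    (sitePattern s k).card = 12 ∧ ∀ q ∈ sitePattern s k, ‖q‖ = 1 := by
  unfold sitePattern
  split_ifs
  · exact ⟨card_fccKissingPattern, fun q hq => norm_eq_one_of_mem_fccKissingPattern hq⟩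
  · exact ⟨card_hcpKissingPattern, fun q hq => norm_eq_one_of_mem_hcpKissingPattern hq⟩

/-- The candidate shell has twelve points (`a ≠ 0`). [folklore] -/
theorem card_shellFinset' (ha : a ≠ 0) (s : ℤ → ℤ) (k : ℤ) : (shellFinset' a s k).card = 12 := by
  unfold shellFinset'
  rw [Finset.card_image_of_injective _ (siteIso' s k).injective,
    Finset.card_image_of_injective _ (smul_right_injective E3 ha), (sitePattern_card_norm s k).1]

/-- The shell window sees exactly the touching neighbours (any ideal Barlow stacking). [folklore] -/
theorem shellWindow_eq_touching' (hs : IsHaggSeq s) (ha : 0 < a) {p : E3}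
    (hp : p ∈ barlowStacking a (a * Real.sqrt (2 / 3)) s) :
    {y : E3 | y ∈ barlowStacking a (a * Real.sqrt (2 / 3)) s ∧ y ≠ p ∧ dist y p ≤ 5 / 4 * a} =
      {y : E3 | y ∈ barlowStacking a (a * Real.sqrt (2 / 3)) s ∧ dist p y = a} := by
  obtain ⟨k, i, j, rfl⟩ := hp
  ext y
  simp only [Set.mem_setOf_eq]
  constructor
  · rintro ⟨hy, hne, hle⟩
    obtain ⟨k', i', j', rfl⟩ := hy
    refine ⟨barlowPos_mem _ _ _, ?_⟩
    have hne' : (k, i, j) ≠ (k', i', j') := by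
      rintro heq
      simp only [Prod.mk.injEq] at heq
      obtain ⟨rfl, rfl, rfl⟩ := heq
      exact hne rfl
    rw [dist_comm] at hle
    exact dist_eq_of_le_of_ideal hs ha (idealRatio_sq a) hne' hle
  · rintro ⟨hy, hd⟩
    refine ⟨hy, fun h => ?_, ?_⟩
    · rw [h, dist_self] at hd; linarith
    · rw [dist_comm, hd]; linarith

/-- Letter shifts across one layer: `L(k+1) − L(k) = s k`, `L(k−1) − L(k) = −s(k−1)`. [folklore] -/
theorem haggLabel_shift (s : ℤ → ℤ) (k : ℤ) :
    haggLabel s (k + 1) - haggLabel s k = s k ∧ haggLabel s (k - 1) - haggLabel s k = -s (k - 1) := by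
  constructor
  · have := haggLabel_sub_haggLabel_succ s k; linarith
  · have := haggLabel_sub_haggLabel_pred s k; linarith

/-- **Each point of the candidate shell is a touching neighbour offset**, for every site type of
every ideal Barlow stacking. [folklore] -/
theorem shellFinset'_subset (hs : IsHaggSeq s) (ha : 0 < a) (k i j : ℤ) :
    (↑(shellFinset' a s k) : Set E3) ⊆
      (fun y : E3 => y - barlowPos a (a * Real.sqrt (2 / 3)) s k i j) ''
        {y : E3 | y ∈ barlowStacking a (a * Real.sqrt (2 / 3)) s ∧
          dist (barlowPos a (a * Real.sqrt (2 / 3)) s k i j) y = a} := by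
  intro z hz
  rw [Finset.mem_coe, shellFinset', Finset.mem_image] at hz
  obtain ⟨_, hq', rfl⟩ := hz
  obtain ⟨q, hq, rfl⟩ := Finset.mem_image.1 hq'
  set p := barlowPos a (a * Real.sqrt (2 / 3)) s k i j with hpdef
  obtain ⟨hup, hdown⟩ := haggLabel_shift s k
  -- a neighbour `y` with `y - p = (siteIso' s k) (a • q)` does the job
  have hnorm : ∀ y : E3, y - p = (siteIso' s k) (a • q) →
      y ∈ barlowStacking a (a * Real.sqrt (2 / 3)) s →
      (siteIso' s k) (a • q) ∈ (fun y : E3 => y - p) ''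
        {y : E3 | y ∈ barlowStacking a (a * Real.sqrt (2 / 3)) s ∧ dist p y = a} := by
    intro y hy hyS
    refine ⟨y, ⟨hyS, ?_⟩, hy⟩
    rw [dist_comm, dist_eq_norm, hy, LinearIsometry.norm_map, norm_smul,
      (sitePattern_card_norm s k).2 q hq, mul_one, Real.norm_of_nonneg ha.le]
  -- the four site types
  rcases hs k with hk | hk <;> rcases hs (k - 1) with hk1 | hk1
  · -- c-site, shifts (+1 up, −1 down): FCC pattern, iso M, neighbour (k + K, i + i', j + j')
    have hpat : sitePattern s k = fccKissingPattern := by simp [sitePattern, hk, hk1]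
    have hsite : siteIso' s k = hexIso := by simp [siteIso', hk]
    rw [hpat] at hq
    obtain ⟨t, ht, hM⟩ := hexIso_fccPattern q hq
    refine hnorm (barlowPos a (a * Real.sqrt (2 / 3)) s (k + t.2.2.2) (i + t.1) (j + t.2.1)) ?_
      (barlowPos_mem _ _ _)
    rw [hsite, LinearIsometry.map_smul, hM, hpdef, barlowPos_sub_barlowPos]
    congr 1
    have hΛ : ((haggLabel s (k + t.2.2.2) - haggLabel s k : ℤ) : ℝ) = t.2.2.1 := by
      rcases fccOffsetIdx_shape t ht with ⟨hK, hΛ⟩ | ⟨hK, hΛ⟩ | ⟨hK, hΛ⟩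
      · rw [hK, hΛ, add_zero, sub_self]
      · rw [hK, hΛ, hup, hk]
      · rw [hK, hΛ, ← sub_eq_add_neg, hdown, hk1]
    rw [hΛ]
    push_cast
    module
  · -- h-site of type A, shifts (+1 up, +1 down): HCP pattern, iso M, neighbour (k + K, i + i', j + j')
    have hpat : sitePattern s k = hcpKissingPattern := by simp [sitePattern, hk, hk1]
    have hsite : siteIso' s k = hexIso := by simp [siteIso', hk]
    rw [hpat] at hq
    obtain ⟨t, ht, hM⟩ := hexIso_hcpPattern q hq
    refine hnorm (barlowPos a (a * Real.sqrt (2 / 3)) s (k + t.2.2.2) (i + t.1) (j + t.2.1)) ?_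
      (barlowPos_mem _ _ _)
    rw [hsite, LinearIsometry.map_smul, hM, hpdef, barlowPos_sub_barlowPos]
    congr 1
    have hΛ : ((haggLabel s (k + t.2.2.2) - haggLabel s k : ℤ) : ℝ) = t.2.2.1 := by
      rcases hcpOffsetIdx_shape t ht with ⟨hK, hΛ⟩ | ⟨hK, hΛ⟩ | ⟨hK, hΛ⟩
      · rw [hK, hΛ, add_zero, sub_self]
      · rw [hK, hΛ, hup, hk]
      · rw [hK, hΛ, ← sub_eq_add_neg, hdown, hk1]; simp
    rw [hΛ]
    push_cast
    module
  · -- h-site of type B, shifts (−1 up, −1 down): HCP pattern, iso −M, neighbour (k − K, i − i', j − j')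
    have hpat : sitePattern s k = hcpKissingPattern := by simp [sitePattern, hk, hk1]
    have hsite : ∀ x : E3, siteIso' s k x = -hexIso x := fun x => by simp [siteIso', hk, hk1]
    rw [hpat] at hq
    obtain ⟨t, ht, hM⟩ := hexIso_hcpPattern q hq
    refine hnorm (barlowPos a (a * Real.sqrt (2 / 3)) s (k - t.2.2.2) (i - t.1) (j - t.2.1)) ?_
      (barlowPos_mem _ _ _)
    rw [hsite, LinearIsometry.map_smul, hM, hpdef, barlowPos_sub_barlowPos, ← smul_neg]
    congr 1
    have hΛ : ((haggLabel s (k - t.2.2.2) - haggLabel s k : ℤ) : ℝ) = -t.2.2.1 := by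
      rcases hcpOffsetIdx_shape t ht with ⟨hK, hΛ⟩ | ⟨hK, hΛ⟩ | ⟨hK, hΛ⟩
      · rw [hK, hΛ, sub_zero, sub_self]; simp
      · rw [hK, hΛ, hdown, hk1]; simp
      · rw [hK, hΛ, sub_neg_eq_add, hup, hk]; simp
    rw [hΛ]
    push_cast
    module
  · -- twin c-site, shifts (−1 up, +1 down): FCC pattern, iso Z ∘ M, neighbour (k − K, i + i', j + j')
    have hpat : sitePattern s k = fccKissingPattern := by simp [sitePattern, hk, hk1]
    have hsite : ∀ x : E3, siteIso' s k x = zIso (hexIso x) := fun x => by simp [siteIso', hk, hk1]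
    rw [hpat] at hq
    obtain ⟨t, ht, hM⟩ := hexIso_fccPattern q hq
    refine hnorm (barlowPos a (a * Real.sqrt (2 / 3)) s (k - t.2.2.2) (i + t.1) (j + t.2.1)) ?_
      (barlowPos_mem _ _ _)
    rw [hsite, LinearIsometry.map_smul, LinearIsometry.map_smul, hM, zIso_combo, hpdef,
      barlowPos_sub_barlowPos]
    congr 1
    have hΛ : ((haggLabel s (k - t.2.2.2) - haggLabel s k : ℤ) : ℝ) = t.2.2.1 := by
      rcases fccOffsetIdx_shape t ht with ⟨hK, hΛ⟩ | ⟨hK, hΛ⟩ | ⟨hK, hΛ⟩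
      · rw [hK, hΛ, sub_zero, sub_self]
      · rw [hK, hΛ, hdown, hk1]; simp
      · rw [hK, hΛ, sub_neg_eq_add, hup, hk]
    rw [hΛ]
    push_cast
    module

/-- **Every point of every ideal Barlow stacking of spacing `a ∈ [9/10, 1]` has a `(1/100)`-good shell**
in the sense of the crux: an EXACT rotated scaled cuboctahedron at `c`-sites (FCC type) and
anticuboctahedron at `h`-sites (HCP type). So H4's per-point clause, like its global clause (§14), holds
for every ideal polytype — H4 does not distinguish stackings (cf. barrier `KissingTwelveDegeneracy`).
[folklore] -/
theorem goodShell_barlowStacking_ideal (hs : IsHaggSeq s) (h9 : 9 / 10 ≤ a) (h1 : a ≤ 1) {p : E3}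
    (hp : p ∈ barlowStacking a (a * Real.sqrt (2 / 3)) s) :
    GoodShell (barlowStacking a (a * Real.sqrt (2 / 3)) s) p := by
  have ha : 0 < a := by linarith
  obtain ⟨k, i, j, rfl⟩ := hp
  have hclose : ShellCloseTo (a / 100) (shellFinset' a s k)
      ((sitePattern s k).image fun v : E3 => a • v) :=
    ⟨siteIso' s k, EtaMatched.refl (by positivity) _⟩
  refine ⟨a, h9, h1, shellFinset' a s k, ?_, ?_⟩
  · rw [shellWindow_eq_touching' hs ha (barlowPos_mem k i j)]
    refine Set.eq_of_subset_of_ncard_le (shellFinset'_subset hs ha k i j) ?_ ?_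
    · rw [Set.ncard_image_of_injective _ sub_left_injective,
        ncard_touching_eq_twelve hs ha (idealRatio_sq a) (barlowPos_mem k i j),
        Set.ncard_coe_finset, card_shellFinset' ha.ne']
    · exact (Set.finite_of_ncard_pos (by
        rw [ncard_touching_eq_twelve hs ha (idealRatio_sq a) (barlowPos_mem k i j)]
        norm_num)).image _
  · unfold sitePattern at hclose
    split_ifs at hclose with hc
    · exact Or.inl hclose
    · exact Or.inr hclose

/-! ### The crux restricted to ideal periodic polytypes -/

variable {n : ℕ}

/-- **The Palm law of every ideal periodic Barlow stacking satisfies H1, H2, H4** (`a ∈ [9/10, 1]`).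
[folklore] -/
theorem barlowPalm_hypotheses (hs : IsHaggSeq s) (hn : n ≠ 0) (hper : ∀ m, s (m + n) = s m)
    (h9 : 9 / 10 ≤ a) (h1 : a ≤ 1) :
    Rooted a (palmLaw (barlowPeriodicConfiguration s (show a ≠ 0 by intro h; rw [h] at h9; norm_num at h9)
      (idealRatio_ne_zero (show a ≠ 0 by intro h; rw [h] at h9; norm_num at h9)) hn hper)) ∧
    PointStationary (palmLaw (barlowPeriodicConfiguration s (show a ≠ 0 by intro h; rw [h] at h9; norm_num at h9)
      (idealRatio_ne_zero (show a ≠ 0 by intro h; rw [h] at h9; norm_num at h9)) hn hper)) ∧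
    Layered (palmLaw (barlowPeriodicConfiguration s (show a ≠ 0 by intro h; rw [h] at h9; norm_num at h9)
      (idealRatio_ne_zero (show a ≠ 0 by intro h; rw [h] at h9; norm_num at h9)) hn hper)) := by
  have ha : 0 < a := by linarith
  set Q := barlowPeriodicConfiguration s (show a ≠ 0 by intro h; rw [h] at h9; norm_num at h9)
      (idealRatio_ne_zero (show a ≠ 0 by intro h; rw [h] at h9; norm_num at h9)) hn hper with hQ
  have hpts : Q.points = barlowStacking a (a * Real.sqrt (2 / 3)) s :=
    barlowPeriodicConfiguration_points s ha.ne' _ hn hper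
  refine ⟨?_, pointStationary_palmLaw Q, ?_⟩
  · refine rooted_palmLaw Q fun p hp q hq hne => ?_
    rw [hpts] at hp hq
    exact le_dist_of_mem_barlowStacking_ideal hs ha (idealRatio_sq a) hp hq hne
  · refine ae_palmLaw Q fun x _ => ⟨view Q x, rfl, ?_, ?_⟩
    · rintro _ ⟨p, hp, rfl⟩
      refine goodShell_image_sub x ?_
      rw [hpts] at hp ⊢
      exact goodShell_barlowStacking_ideal hs h9 h1 hp
    · refine barlowLike_image_sub x ?_
      rw [hpts]
      exact barlowLike_barlowStacking_ideal hs h9 h1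

/-- **The crux, restricted to ideal periodic polytypes, is the ATTAINMENT form of Hägg selection**: if
`LayeredLawsSelectHcp` holds, then no ideal periodic Barlow stacking of admissible spacing attains the
periodic infimum `e*` unless, seen from each of its motif points, it is a linear-isometric copy of an
`hcpStacking a' h'` with optimal parameters. Contrapositively: ONE ideal polytype `s` (any period) and ONE
`a ∈ [9/10, 1]` with `e(barlowPeriodicConfiguration a (a√⅔) s) ≤ e*` and a motif view not congruent to hcp
refutes the crux — this is exactly where the uncertified couplings `J_k` (items 0670/3063) enter. [folklore] -/
theorem isRelaxedHcp_of_crux_barlow (H : LayeredLawsSelectHcp) (hs : IsHaggSeq s) (hn : n ≠ 0)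
    (hper : ∀ m, s (m + n) = s m) (h9 : 9 / 10 ≤ a) (h1 : a ≤ 1)
    (hE : (barlowPeriodicConfiguration s (show a ≠ 0 by intro h; rw [h] at h9; norm_num at h9)
      (idealRatio_ne_zero (show a ≠ 0 by intro h; rw [h] at h9; norm_num at h9)) hn hper).energyPerParticle
        lennardJones ≤ eStar) :
    ∀ x ∈ (barlowPeriodicConfiguration s (show a ≠ 0 by intro h; rw [h] at h9; norm_num at h9)
      (idealRatio_ne_zero (show a ≠ 0 by intro h; rw [h] at h9; norm_num at h9)) hn hper).motif,
      IsRelaxedHcp (viewMeasure (barlowPeriodicConfiguration s (show a ≠ 0 by intro h; rw [h] at h9; norm_num at h9)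
        (idealRatio_ne_zero (show a ≠ 0 by intro h; rw [h] at h9; norm_num at h9)) hn hper) x) := by
  obtain ⟨hr, h2, h4⟩ := barlowPalm_hypotheses hs hn hper h9 h1
  exact of_ae_palmLaw _ (crux_iff.1 H a (by linarith) _ inferInstance hr h2
    (by rw [meanRootEnergy_palmLaw]; exact hE) h4)

end AllStackings

end Summit.AtomisticToContinuum.Crystallization.Theorems.LayeredLawsSelectHcp.Negative.AllStackings

end
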